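import Literature.IUT.HodgeTheaters.PiAvatarLocalArrowLawOfTorsionMonodromy
import Literature.IUT.HodgeTheaters.InitialThetaDataTorsionMonodromyModelInertia
import HarnessLib

/-!
# [IUTchI] §1 p.37 / Def 3.1 (c)(d) / Def 6.1 (v): the `l`-TORSION MONODROMY of `X_F`, UNRAMIFIED AT THE CUSPS — the
# v-next interface datum `UnramifiedTorsionMonodromy` = `TorsionMonodromy` + ONE field `tau_inertia`
# (post-freeze ADDITIVE interface module closing GAP-LEDGER G-L5d5g6-1; a NAMED DATUM — nothing frozen is touched)

S. Mochizuki, *Inter-universal Teichmüller theory I*, kurims manuscript (May 2020), §1 p. 37 l. 50–58 «`Δ_X̲ ↠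
Δ_X̲^{ab} ⊗ (ℤ/lℤ) ↠ Δ_ε` for the quotient of `Δ_X̲^{ab} ⊗ (ℤ/lℤ)` by the images of the inertia groups of all nonzero
cusps `≠ ε′, ε″` of `X̲`.  Thus, we obtain a natural exact sequence `0 → I_{ε′} × I_{ε″} → Δ_ε → Δ_E ⊗ (ℤ/lℤ) → 0` —
where we write `E` for the genus one compactification of `X̲`, and `I_{ε′}`, `I_{ε″}` for the respective images in
`Δ_ε` of the inertia groups of the cusps `ε′`, `ε″`» (so EVERY cusp inertia group of `X̲` dies in `Δ_E ⊗ (ℤ/lℤ)`, hence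
— `E → E_F` being an isogeny — in `Δ_{X_F}^{ab} ⊗ 𝔽_l = E_F[l]`), §3 Definition 3.1 (d) p. 62 «`X̲_K` of type
`(1, l-tors)` [cf. [EtTh], Definition 2.1]», §6 Definition 6.1 (v) p. 158 «the outer homomorphism `Aut(𝒟^{⊚±}) →
GL₂(𝔽_l)/{±1}` arising from the `l`-torsion points of the elliptic curve `E_F` [i.e., from the Galois action on
`Δ_X^{ab} ⊗ 𝔽_l`] … the rank one quotient of `Δ_X^{ab} ⊗ 𝔽_l` that gives rise to the covering `X̲_K → X_K`», and
Corollary 1.2 proof p. 39 «`Π_X̲ = Π_{X→} · H`, `H := Ker(Δ_X ↠ Δ_X^{ab} ⊗ ℤ/l)`» ([IUTchI] §1 p.37, Def 3.1 (d)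
p.62, Def 6.1 (v) p.158, Cor 1.2 p.39) [claim: Mochizuki2012, status: disputed] (D-0012 claim key; series status
DISPUTED — this file TYPES one interface datum over abc-iut-L5-t2's REAL `InitialThetaData` and re-exports
abc-iut-L5-d5's finite-group-theory derivations; nothing of the series is asserted; no side taken on [IUTchIII] Cor. 3.12).

## WHY (GAP-LEDGER G-L5d5g6-1 «TorsionMonodromy v-next field tau_inertia», owner = this lineage; abc-iut-L5-lead gen 6
## RULINGS #60 (1), #63 (3); abc-iut-L5-d5's p445209)

abc-iut-L5-t8's v1 datum `InitialThetaData.TorsionMonodromy D` (p433356, FROZEN S-g4-10: cocycle `τ : Π_{X_F} →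
E_F[l](F̄)`, line `𝔽_l·gen`, «`Π_{X̲_K} = {k ∈ Π_{X_K} | τ k ∈ ℤ·gen}`») records [EtTh] Def 2.1's «`D_x → Q` is trivial»
only MODULO THE LINE.  abc-iut-L5-d5's Borel argument (`TorsionMonodromy.localArrowLaw_L1_of_torsionMonodromy` /
`…_L1_local`, p445209) derives the local arrow law (L1) of abc-iut-L5-t4's `LocalArrowLaw` from `M`, the §1 claims
`hA : D.geom.pe.ArrowCoveringClaims`, and ONE further named binder `hI : ∀ k ∈ I_{ε′}, τ(embK k) = 0` — the `E_F[l]`-level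
statement «the cusp inertia dies under the `l`-torsion monodromy», which print's p. 37 exact sequence displays and
which is classical for the genuine curve (`I_x ⊆` closure of `⁅Δ_X, Δ_X⁆`, `Δ_X ≅ F̂₂`; `τ` continuous and additive on
`Δ_X`).  The GAP row's «permanent fix» is typed here: ONE ADDITIVE FIELD on a v-next structure EXTENDING the frozen one,
so that every v1 consumer is fed by `M.toTorsionMonodromy` and `hI` is discharged by `M.tau_inertia_ε1`.

## WHAT

* `InitialThetaData.UnramifiedTorsionMonodromy D` — `structure … extends D.TorsionMonodromy` with the single new law
  `tau_inertia : ∀ x : D.geom.pe.Cusp, ∀ k ∈ D.geom.pe.inertia x, tau (D.geom.embK k) = 0` (all cusps of `X̲_K`; the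
  consumer uses `x = ε′`);
* re-exports WITHOUT the binder `hI` (proofs = abc-iut-L5-d5's theorems applied to `M.toTorsionMonodromy` and
  `M.tau_inertia_ε1`): `UnramifiedTorsionMonodromy.exists_mem_jKer_tau_eq_smul_gen` (the crux «`τ(Δ_{X̲→}) ≠ 0`»),
  **`UnramifiedTorsionMonodromy.localArrowLaw_L1`** (every `H ⊇ embK(jKer)`) and
  **`UnramifiedTorsionMonodromy.localArrowLaw_L1_local`** (the local groups `Π_v̲ = Π_{X̲→_K} ∩ augGF⁻¹(G_v̲)`): the
  (L1) field of `LocalArrowLaw` is a THEOREM from `{M : D.UnramifiedTorsionMonodromy, hA}`; and, over abc-iut-L5-d5's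
  assembly `localArrowLaw_local_of_torsionMonodromy` (p446888, (L1) + (L2) `sign`), the WHOLE binder
  **`UnramifiedTorsionMonodromy.localArrowLaw_local CG hS hA Gv : D.LocalArrowLaw CG hS (Π_{X̲→_K} ∩ augGF⁻¹ G_v̲)`** and
  `localArrowLaw_local_of_nonempty` (from `Nonempty D.UnramifiedTorsionMonodromy` + `hA`);
* NON-VACUITY (model; «[degenerate at the inertia]», see `…ModelInertia.lean`):
  `InitialThetaData.unramifiedTorsionMonodromyRegeom D₀ : D₀.regeom.UnramifiedTorsionMonodromy` (the gen-6 term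
  `torsionMonodromyRegeom D₀` + `tau_regeom_embK_eq_zero_of_mem_inertia`), `nonempty_unramifiedTorsionMonodromy_regeom`,
  `exists_unramifiedTorsionMonodromy` (same `V^bad_mod`, `V̲` as any given `D₀`), and the `ofArith` variants.

HONEST LABEL.  A NAMED DATUM (binder) of the genuine situation, CONSUMED by name; NOT constructed for the genuine curve
(needs `π₁^{ét}(E_{F̄}) ≅ T(E)`, plan/FOUNDATIONS.md row 12); the model inhabitant has TRIVIAL cusp inertia (consistency
evidence only) and does NOT satisfy `ArrowCoveringClaims` (`InitialThetaData.not_arrowCoveringClaims_regeom`), so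
`{M, hA}` is not jointly witnessed by it.  No `instance`, no notation, no `Prop` fact; the v1 structure is untouched.
Binder effect for certificate writers: `{Nonempty D.TorsionMonodromy, hI}` ↦ `{Nonempty D.UnramifiedTorsionMonodromy}`
(`Nonempty.map UnramifiedTorsionMonodromy.toTorsionMonodromy` recovers the v1 binder).  typed ≠ constructed ≠ proved;
nothing here bears on [IUTchIII] Cor. 3.12.
-/

noncomputable section

namespace Literature.IUT.HodgeTheaters

open scoped WeierstrassCurve.Affine Classical

universe u v w

/-! ## The v-next interface datum -/

section Interface

variable {F : Type u} {K : Type v} {Fbar : Type w} [Field F] [NumberField F] [Field K] [NumberField K]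
  [Algebra F K] [Field Fbar] [Algebra F Fbar] [Algebra K Fbar]
  {E : WeierstrassCurve F} [E.IsElliptic] {l : ℕ} {Pb : BadPlacePredicates K}

namespace InitialThetaData

/-- **The `l`-torsion monodromy of `X_F`, unramified at the cusps** ([IUTchI] Def 3.1 (c)(d) p.62 with [EtTh] Def 2.1
p.36; Def 6.1 (v) p.158; §1 p.37 «`0 → I_{ε′} × I_{ε″} → Δ_ε → Δ_E ⊗ (ℤ/lℤ) → 0` … `E` … the genus one
compactification of `X̲`»): abc-iut-L5-t8's datum `TorsionMonodromy` (translation cocycle `τ : Π_{X_F} → E_F[l](F̄)`,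
line `𝔽_l·gen`, `Π_{X̲_K} = {k ∈ Π_{X_K} | τ k ∈ ℤ·gen}`) TOGETHER WITH the law that `τ` kills the inertia group of
every cusp of `X̲_K` (the cusp inertia dies in the genus-one compactification, hence in `Δ_X^{ab} ⊗ 𝔽_l = E_F[l]`).
A NAMED DATUM over `D : InitialThetaData`, consumed by name, not constructed here (v-next of the frozen v1 structure,
which it extends; GAP-LEDGER G-L5d5g6-1). ([IUTchI] Def 6.1 (v) p.158) [claim: Mochizuki2012, status: disputed] -/
structure UnramifiedTorsionMonodromy (D : InitialThetaData F K Fbar E l Pb) extends D.TorsionMonodromy where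
  /-- «the inertia groups of the cusps» of `X̲` die in `Δ_E ⊗ (ℤ/lℤ)` (§1 p.37 exact sequence; `E → E_F` an isogeny):
  for every cusp `x` of `X̲_K` and every `k` in its inertia group `I_x = D_x ∩ Δ_{C_K}`, `τ(embK k) = 0`
  (the v-next FIELD asked by GAP-LEDGER G-L5d5g6-1; abc-iut-L5-d5's binder `hI` is the case `x = ε′`) -/
  tau_inertia : ∀ x : D.geom.pe.Cusp, ∀ k ∈ D.geom.pe.inertia x, tau (D.geom.embK k) = 0

namespace UnramifiedTorsionMonodromy

variable {D : InitialThetaData F K Fbar E l Pb} (M : D.UnramifiedTorsionMonodromy)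

/-- abc-iut-L5-d5's binder `hI`, DISCHARGED from the datum: `τ` kills the inertia group of the cusp `ε′`.
[cite: Mochizuki2012, IUTchI §1 p.37] -/
theorem tau_inertia_ε1 : ∀ k ∈ D.geom.pe.inertia D.geom.pe.ε1, M.tau (D.geom.embK k) = 0 :=
  M.tau_inertia D.geom.pe.ε1

/-- The v1 binder is recovered from the v-next one. [cite: Mochizuki2012, IUTchI Def 6.1 (v) p.158] -/
theorem nonempty_torsionMonodromy (h : Nonempty D.UnramifiedTorsionMonodromy) : Nonempty D.TorsionMonodromy :=
  h.map UnramifiedTorsionMonodromy.toTorsionMonodromy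

/-- **The crux «`τ(Δ_{X̲→}) ≠ 0`» without the binder `hI`** (abc-iut-L5-d5's (C) applied to the datum): given the
printed §1 claims, some `k₀ ∈ jKer = Δ_{X̲→}` has `τ(embK k₀) = a·gen` with `l ∤ a` («`Π_X̲ = Π_{X→} · H`»,
Cor 1.2 proof p.39). [cite: Mochizuki2012, IUTchI Cor 1.2 p.39] -/
theorem exists_mem_jKer_tau_eq_smul_gen (hA : D.geom.pe.ArrowCoveringClaims) :
    ∃ k₀ ∈ D.geom.pe.jKer, ∃ a : ℤ, ¬ (l : ℤ) ∣ a ∧ M.tau (D.geom.embK k₀) = a • M.gen :=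
  M.toTorsionMonodromy.exists_mem_jKer_tau_eq_smul_gen hA M.tau_inertia_ε1

include M in
/-- **[IUTchI] Ex 6.3 (i) / Def 6.1 (iii) — the LOCAL ARROW LAW (L1) from `{M, hA}` alone**: for EVERY subgroup
`H ⊇ embK(jKer)` of `Π_{C_F}`, an element `d` with `d⁻¹ H d ≤ Π_{X̲_K}` NORMALISES `Π_{X̲_K}` («morphisms `𝒟_v̲ → 𝒟^{⊚±}`
are `Aut(𝒟^{⊚±})`-translates of `φ^{Θell}_{•,v̲}`») — abc-iut-L5-d5's Borel argument with its binder `hI` discharged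
by `tau_inertia`; the field `LocalArrowLaw.mem_normalizer_of_conj_le` of abc-iut-L5-t4's interface law, verbatim in
its conclusion. [cite: Mochizuki2012, IUTchI Ex 6.3 (i) p.161] -/
theorem localArrowLaw_L1 (hA : D.geom.pe.ArrowCoveringClaims) {H : Subgroup D.PiC}
    (hjH : D.geom.pe.jKer.map D.geom.embK ≤ H) :
    ∀ d : D.PiC, (∀ x ∈ H, d⁻¹ * x * d ∈ D.PiXund) →
      d ∈ Subgroup.normalizer ((D.PiXund : Subgroup D.PiC) : Set D.PiC) :=
  M.toTorsionMonodromy.localArrowLaw_L1_of_torsionMonodromy hA M.tau_inertia_ε1 hjH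

include M in
/-- **(L1) at the LOCAL GROUPS `Π_v̲ = Π_{X̲→_K} ∩ augGF⁻¹(G_v̲)`** (every subgroup `G_v̲ ≤ G_F`) from `{M, hA}` alone:
the field `mem_normalizer_of_conj_le` of `D.LocalArrowLaw CG hS (D.PiXarrow ⊓ Gv.comap D.augGF)` — bind it as
`Λ.mem_normalizer_of_conj_le := M.localArrowLaw_L1_local hA Gv`. [cite: Mochizuki2012, IUTchI Ex 6.3 (i) p.161] -/
theorem localArrowLaw_L1_local (hA : D.geom.pe.ArrowCoveringClaims) (Gv : Subgroup (Fbar ≃ₐ[F] Fbar)) :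
    ∀ d : D.PiC, (∀ x ∈ D.PiXarrow ⊓ Gv.comap D.augGF, d⁻¹ * x * d ∈ D.PiXund) →
      d ∈ Subgroup.normalizer ((D.PiXund : Subgroup D.PiC) : Set D.PiC) :=
  M.toTorsionMonodromy.localArrowLaw_L1_local hA M.tau_inertia_ε1 Gv

include M in
/-- **The whole LOCAL ARROW LAW `Λ` of `Π_v̲ = Π_{X̲→_K} ∩ augGF⁻¹(G_v̲)` from `{M, hA}`** ([IUTchI] Def 6.1 (ii)(iii), Ex 6.3
(i)): abc-iut-L5-d5's assembly `localArrowLaw_local_of_torsionMonodromy` (p446888: `le_PiXund`, (L1), (L2) `sign`) with its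
binder `hI` discharged by `tau_inertia` — abc-iut-L5-t4's binder `Λ : D.LocalArrowLaw CG hS (D.PiXarrow ⊓ Gv.comap D.augGF)`
for EVERY `G_v̲ ≤ G_F`. [cite: Mochizuki2012, IUTchI Def 6.1 (iii) p.157] -/
theorem localArrowLaw_local (CG : D.geom.pe.CuspGalois) (hS : D.CuspClassesNormaliserStable) [Fact l.Prime]
    (hA : D.geom.pe.ArrowCoveringClaims) (Gv : Subgroup (Fbar ≃ₐ[F] Fbar)) :
    D.LocalArrowLaw CG hS (D.PiXarrow ⊓ Gv.comap D.augGF) :=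
  localArrowLaw_local_of_torsionMonodromy CG hS M.toTorsionMonodromy hA M.tau_inertia_ε1 Gv

/-- **Non-vacuity of abc-iut-L5-t4's binder type `LocalArrowLaw` at the local groups, relative to the REDUCED binder set
`{Nonempty D.UnramifiedTorsionMonodromy, hA}`.** [cite: Mochizuki2012, IUTchI Def 6.1 (iii) p.157] -/
theorem localArrowLaw_local_of_nonempty (CG : D.geom.pe.CuspGalois) (hS : D.CuspClassesNormaliserStable) [Fact l.Prime]
    (hM : Nonempty D.UnramifiedTorsionMonodromy) (hA : D.geom.pe.ArrowCoveringClaims) (Gv : Subgroup (Fbar ≃ₐ[F] Fbar)) :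
    D.LocalArrowLaw CG hS (D.PiXarrow ⊓ Gv.comap D.augGF) := by
  obtain ⟨M⟩ := hM
  exact M.localArrowLaw_local CG hS hA Gv

end UnramifiedTorsionMonodromy

end InitialThetaData

end Interface

/-! ## Non-vacuity at the re-geometrised semidirect model (abc-iut-L5-t8 gen 6/7; «[degenerate at the inertia]») -/

section Model

variable {F K Fbar : Type u} [Field F] [NumberField F] [Field K] [NumberField K] [Algebra F K] [Field Fbar]
  [Algebra F Fbar] [Algebra K Fbar] {E : WeierstrassCurve F} [E.IsElliptic] {l : ℕ} {Pb : BadPlacePredicates K}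

namespace InitialThetaData

/-- **The unramified `l`-torsion monodromy TERM of the re-geometrised datum**: the gen-6 term
`torsionMonodromyRegeom D₀` (`τ ⟨t, (σ, u)⟩ = t`) with `tau_inertia` supplied by
`tau_regeom_embK_eq_zero_of_mem_inertia` (the model's cusp inertia groups are trivial — consistency evidence,
not a discharge at the genuine curve). [cite: Mochizuki2012, IUTchI Def 6.1 (v) p.158] -/
def unramifiedTorsionMonodromyRegeom (D₀ : InitialThetaData F K Fbar E l Pb) :
    D₀.regeom.UnramifiedTorsionMonodromy :=
  ⟨D₀.torsionMonodromyRegeom, D₀.tau_regeom_embK_eq_zero_of_mem_inertia⟩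

/-- The underlying v1 term is the gen-6 term `torsionMonodromyRegeom D₀`. [cite: Mochizuki2012, IUTchI Def 6.1 (v) p.158] -/
theorem unramifiedTorsionMonodromyRegeom_toTorsionMonodromy (D₀ : InitialThetaData F K Fbar E l Pb) :
    D₀.unramifiedTorsionMonodromyRegeom.toTorsionMonodromy = D₀.torsionMonodromyRegeom := rfl

/-- **NON-VACUITY of the v-next datum**: the re-geometrised initial Θ-datum CARRIES an `UnramifiedTorsionMonodromy`.
[cite: Mochizuki2012, IUTchI Def 6.1 (v) p.158] -/
theorem nonempty_unramifiedTorsionMonodromy_regeom (D₀ : InitialThetaData F K Fbar E l Pb) :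
    Nonempty D₀.regeom.UnramifiedTorsionMonodromy :=
  ⟨D₀.unramifiedTorsionMonodromyRegeom⟩

/-- **For every initial Θ-datum there is one with the same arithmetic data (`V^bad_mod`, `V̲`) and an unramified
torsion monodromy** — the binder `Nonempty D.UnramifiedTorsionMonodromy` is satisfiable at genuine arithmetic data
(KIT RULE non-vacuity). [cite: Mochizuki2012, IUTchI Def 6.1 (v) p.158] -/
theorem exists_unramifiedTorsionMonodromy (D₀ : InitialThetaData F K Fbar E l Pb) :
    ∃ D : InitialThetaData F K Fbar E l Pb,
      D.VbadMod = D₀.VbadMod ∧ D.V = D₀.V ∧ Nonempty D.UnramifiedTorsionMonodromy :=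
  ⟨D₀.regeom, rfl, rfl, D₀.nonempty_unramifiedTorsionMonodromy_regeom⟩

omit [NumberField K] [Algebra F K] [Algebra K Fbar] in
/-- **For every arithmetic input there is an initial Θ-datum with an unramified torsion monodromy** (over
`K := F(E_F[l])`, `F̄ := AlgebraicClosure F`, with the given `V^bad_mod` and bad-place predicates): abc-iut-L5-t7's
`ofArith` followed by `regeom`. [cite: Mochizuki2012, IUTchI Def 6.1 (v) p.158] -/
theorem exists_ofArith_unramifiedTorsionMonodromy (A : ArithInput E l) [NeZero l]
    (Pb : BadPlacePredicates (TorsionField E l))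
    (hbad_type : ∀ w : Val (TorsionField E l),
      toVMod F (TorsionField E l) E w ∈ Val.non '' A.VbadMod → Pb.IsTypeOneZModLPM w)
    (hbad_cusp : ∀ w : Val (TorsionField E l),
      toVMod F (TorsionField E l) E w ∈ Val.non '' A.VbadMod → Pb.IsCanonicalGeneratorCusp w) :
    ∃ D : InitialThetaData F (TorsionField E l) (AlgebraicClosure F) E l Pb,
      D.VbadMod = A.VbadMod ∧ Nonempty D.UnramifiedTorsionMonodromy := by
  haveI : IsGalois F (AlgebraicClosure F) := {}
  obtain ⟨geom⟩ := ThetaGeometryModel.nonempty_thetaGeometry_galois F (TorsionField E l) (AlgebraicClosure F)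
    A.five_le_l (TorsionMonodromyModel.coprime_six_of_prime l A.l_prime A.five_le_l)
  let D₀ := InitialThetaData.ofArith E l A Pb geom hbad_type hbad_cusp
  exact ⟨D₀.regeom, rfl, D₀.nonempty_unramifiedTorsionMonodromy_regeom⟩

omit [NumberField K] [Algebra F K] [Algebra K Fbar] in
/-- The same with the trivial bad-place predicates: an initial Θ-datum with an unramified torsion monodromy EXISTS
for every arithmetic input. [cite: Mochizuki2012, IUTchI Def 6.1 (v) p.158] -/
theorem exists_ofArith_unramifiedTorsionMonodromy_trivial (A : ArithInput E l) [NeZero l] :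
    ∃ D : InitialThetaData F (TorsionField E l) (AlgebraicClosure F) E l (BadPlacePredicates.trivial _),
      D.VbadMod = A.VbadMod ∧ Nonempty D.UnramifiedTorsionMonodromy :=
  exists_ofArith_unramifiedTorsionMonodromy A _ (fun _ _ => trivial) (fun _ _ => trivial)

end InitialThetaData

end Model

end Literature.IUT.HodgeTheaters

end
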